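import Summits.Parity.GeneralizedHardyLittlewood.Theorems.PrimeLevelFamEdgeIdeaDeltasWucLadderSubPower
import Literature.NumberTheory.LFunctions.HeckeLandauPageLowerBound
import Literature.NumberTheory.LFunctions.HeckeLOneBound
import Literature.NumberTheory.QuadraticFields.ClassGroupExponentTwoCriteria
import Literature.NumberTheory.QuadraticFields.ConvenientNumbers
import HarnessLib

/-!
# Route `PrimeLevelFamEdge` — TYPED IDEA DELTAS, deck 11″: `wuc` ladder, wave 2 — TOWERS on the ∃-rail and the
# GENUS RUNG on the explicit rail (cell ls-idea, seat ls-idea-lens-13 gen 2, cards K-L13-4 «TOWERS», K-L13-5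
# «GENUS RAIL», K-L13-6 «EXPONENT-DEMAND TABLE»; LANDING NOTE typer ls-idea-typ-1 gen 2: the seat's
# `Sketch_WucWave2.lean` sha16 2732e86b4657a1b7 VERBATIM up to (i) namespace = deck 11's, (ii) the 0-ary open
# rung `EulerListComplete` replaced by the PARAMETRIC rung `NoConvenientNumberBeyond N` with Euler-completeness
# inlined as a hypothesis where used, (iii) `one_lt_log_of_three_le` private (tree duplicate under `XYZ`).)

Over typ-1's landed decks 11/11′ (`LOneShape`, p598666 / p599362 / p599585) this file adds, kernel-checked over
TREE theorems only (no new analytic input):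

* Part A (towers). `LOneShapeEv g` (eventual ∃-rung) and `lOneShape_of_eventually`: at ANY shape `g > 0`
  finitely many exceptional moduli cost nothing (Dirichlet `L(1,χ) ≠ 0` + a finite minimum) — so every
  «at most k exceptions at shape g» theorem (Tatuzawa type) sits ON the ∃-rung of shape `g`, and the whole open
  content of an ∃-rung is the FINITENESS (equivalently emptiness) of its exceptional tower. `LOneShapeOn F g`
  (family-restricted rung): bounded families are free (`lOneShapeOn_of_lt`), a rung is the conjunction of its
  restrictions to a family and the complement (`lOneShape_of_on_of_on_compl`) — the typed form of «open for
  every explicit infinite family». The HECKE DICTIONARY between minorant shapes and real-zero-free widths: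
  `lOneShape_of_realZeroFreeShape` (M–V Thm 11.4 (11.7)/(11.10), tree `heckeLandauPageLB_holds`: width `g` ⇒
  minorant `g`, for `g ≤ 1/log D`) and `realZeroFreeShape_of_lOneShape` (tree
  `MontgomeryVaughan2007_thm11_4_LOne_exceptional_holds`, (11.10): minorant `g` ⇒ width `g/log²D`). So the
  ∃-rail of deck 11 IS the rail of explicit real-zero-free widths, up to `log² D`.
* Part B (genus rail). `OneClassPerGenus D` (every reduced primitive form of discriminant `D` ambiguous ⟺
  `h(D) = 2^{μ−1}` ⟺ `C(D)` has exponent ≤ 2: tree `classNumber_eq_two_pow_iff_forall_ambiguous`, Cox Thm 3.22 —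
  a NAME for the tree's inline phrase, nothing new), the EXPLICIT-rail rung `NoOneClassPerGenusBeyond N` («no
  discriminant `D < −N` has one class per genus»; `N = 7392 = 4·1848`: Euler 1778 / Gauss D.A. art. 303; OPEN —
  Weinberger 1973: at most one more fundamental one; none on GRH), its h-currency reading
  (`noOneClassPerGenusBeyond_iff_classNumber_ne`), the finite-window bookkeeping
  (`noOneClassPerGenusBeyond_of_window`, the kernel window `(7392, 7408]`), kernel instances (`−3315, −5460,
  −7392` have one class per genus), and the PARAMETRIC rung `NoConvenientNumberBeyond N` (no convenient number
  beyond `N`; at `N = 1848` = «Euler's 65 numeri idonei are all of them beyond the table», OPEN) with the PROVED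
  implications `(∀ n, IsConvenientNumber n → n ∈ eulerConvenientNumbers) → NoConvenientNumberBeyond 1848` and
  `NoConvenientNumberBeyond N → ∀ n > N, ¬ OneClassPerGenus (−4n)` (`N ≥ 1`; tree
  `isConvenientNumber_of_forall_ambiguous`, Cox Prop 3.24 ⟸).

HONESTY: no exceptional-zero theorem (no Landau–Siegel / Siegel-zero exclusion, no Theorem 1–2 of
arXiv:2211.02515, no repaired Margin232) is proved here; the OPEN rungs are PARAMETRIC `def`s, not claims;
Euler's problem, every ∃-rung below the leaf and every explicit rung above GGZ remain OPEN; typed ≠ proved.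
-/

noncomputable section

namespace Summit.Parity.GeneralizedHardyLittlewood.Theorems.PrimeLevelFamEdgeIdeaDeltas.Wuc

open Literature.NumberTheory.LFunctions
open Literature.NumberTheory.LFunctions.Zhang2022.Skeleton

/-! ## Part A — towers: eventual rungs, family rungs, and the Hecke dictionary -/

/-- On a finite index type a pointwise-positive real function is strictly bounded below by a positive
constant. [folklore] -/
theorem exists_pos_lt_of_finite {ι : Type*} [Finite ι] (f : ι → ℝ) (hf : ∀ i, 0 < f i) :
    ∃ c : ℝ, 0 < c ∧ ∀ i, c < f i := by
  cases isEmpty_or_nonempty ι with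
  | inl h => exact ⟨1, one_pos, fun i => (IsEmpty.false i).elim⟩
  | inr h =>
    obtain ⟨i₀, hi₀⟩ := Finite.exists_min f
    exact ⟨f i₀ / 2, by linarith [hf i₀], fun i => by linarith [hf i₀, hi₀ i]⟩

/-- **Small moduli are free at any positive shape.** For every `D₀` there is `c' > 0` with
`c'·g(D) < ‖L(1,χ)‖` for all `3 ≤ D < D₀` and all primitive `χ mod D` (finitely many characters, each with
`L(1,χ) ≠ 0`). [folklore] -/
theorem exists_const_lt_moduli {g : ℕ → ℝ} (hg : ∀ D : ℕ, 3 ≤ D → 0 < g D) (D₀ : ℕ) :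
    ∃ c' : ℝ, 0 < c' ∧ ∀ (D : ℕ) [NeZero D] (χ : DirichletCharacter ℂ D),
      3 ≤ D → D < D₀ → χ.IsPrimitive → c' * g D < ‖χ.LFunction 1‖ := by
  let ι := (e : Fin D₀) × {χ : DirichletCharacter ℂ ((e : ℕ) + 3) // χ ≠ 1}
  let f : ι → ℝ := fun i => ‖i.2.1.LFunction 1‖ / g ((i.1 : ℕ) + 3)
  have hf : ∀ i, 0 < f i := by
    rintro ⟨e, χ, hχ⟩
    have hL : χ.LFunction 1 ≠ 0 :=
      DirichletCharacter.LFunction_ne_zero_of_one_le_re χ (Or.inl hχ) (by simp)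
    exact div_pos (norm_pos_iff.mpr hL) (hg _ (by omega))
  obtain ⟨c', hc', hcf⟩ := exists_pos_lt_of_finite f hf
  refine ⟨c', hc', fun D _ χ hD hlt hprim => ?_⟩
  obtain ⟨e, rfl⟩ : ∃ e : ℕ, D = e + 3 := ⟨D - 3, by omega⟩
  have he : e < D₀ := by omega
  have hne : χ ≠ 1 := ne_one_of_isPrimitive_of_three_le hprim hD
  have key := hcf ⟨⟨e, he⟩, ⟨χ, hne⟩⟩
  simp only [f] at key
  rwa [lt_div_iff₀ (hg _ hD)] at key

/-- **Eventual ∃-rung of shape `g`**: `∃ c > 0, ∃ D₀, c·g(D) < ‖L(1,χ)‖` for all real primitive `χ` mod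
`D ≥ max(D₀, 3)` — i.e. all but finitely many moduli. [cite: IwaniecConversations2006, §7 (7.7) (shape)] -/
def LOneShapeEv (g : ℕ → ℝ) : Prop :=
  ∃ c : ℝ, 0 < c ∧ ∃ D₀ : ℕ, ∀ (D : ℕ) [NeZero D] (χ : DirichletCharacter ℂ D),
    D₀ ≤ D → 3 ≤ D → χ.IsQuadratic → χ.IsPrimitive → c * g D < ‖χ.LFunction 1‖

/-- **Finitely many exceptions cost nothing, at ANY positive shape**: `LOneShapeEv g → LOneShape g`
(generalises the tree's `lOneLowerBound_of_eventual` from `(log D)^{-A}` to arbitrary `g > 0`). Reading: an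
«at most `k` exceptional moduli at shape `g`» theorem already proves the ∃-rung of shape `g`; the open
content of an ∃-rung is exactly the finiteness of its exceptional tower. [folklore] -/
theorem lOneShape_of_eventually {g : ℕ → ℝ} (hg : ∀ D : ℕ, 3 ≤ D → 0 < g D) (h : LOneShapeEv g) :
    LOneShape g := by
  obtain ⟨c, hc, D₀, hD₀⟩ := h
  obtain ⟨c', hc', hsmall⟩ := exists_const_lt_moduli hg D₀
  refine ⟨min c c', lt_min hc hc', fun D _ χ hD hq hp => ?_⟩
  by_cases hlarge : D₀ ≤ D
  · calc min c c' * g D ≤ c * g D := mul_le_mul_of_nonneg_right (min_le_left _ _) (hg D hD).le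
      _ < ‖χ.LFunction 1‖ := hD₀ D χ hlarge hD hq hp
  · push Not at hlarge
    calc min c c' * g D ≤ c' * g D := mul_le_mul_of_nonneg_right (min_le_right _ _) (hg D hD).le
      _ < ‖χ.LFunction 1‖ := hsmall D χ hD hlarge hp

/-- The converse is trivial: a full rung is an eventual rung (`D₀ = 0`). [folklore] -/
theorem lOneShapeEv_of_lOneShape {g : ℕ → ℝ} (h : LOneShape g) : LOneShapeEv g := by
  obtain ⟨c, hc, h⟩ := h
  exact ⟨c, hc, 0, fun D _ χ _ hD hq hp => h D χ hD hq hp⟩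

/-- **Family-restricted ∃-rung**: shape `g` demanded only for moduli `D ∈ F`. [folklore] -/
def LOneShapeOn (F : Set ℕ) (g : ℕ → ℝ) : Prop :=
  ∃ c : ℝ, 0 < c ∧ ∀ (D : ℕ) [NeZero D] (χ : DirichletCharacter ℂ D),
    D ∈ F → 3 ≤ D → χ.IsQuadratic → χ.IsPrimitive → c * g D < ‖χ.LFunction 1‖

/-- The full family is the rung. [folklore] -/
theorem lOneShapeOn_univ_iff (g : ℕ → ℝ) : LOneShapeOn Set.univ g ↔ LOneShape g := by
  constructor
  · rintro ⟨c, hc, h⟩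
    exact ⟨c, hc, fun D _ χ hD hq hp => h D χ (Set.mem_univ _) hD hq hp⟩
  · rintro ⟨c, hc, h⟩
    exact ⟨c, hc, fun D _ χ _ hD hq hp => h D χ hD hq hp⟩

/-- Monotone in the family (smaller) and the shape (smaller). [folklore] -/
theorem lOneShapeOn_mono {F F' : Set ℕ} {g g' : ℕ → ℝ} (hF : F' ⊆ F)
    (hgg : ∀ D ∈ F', 3 ≤ D → g' D ≤ g D) (h : LOneShapeOn F g) : LOneShapeOn F' g' := by
  obtain ⟨c, hc, h⟩ := h
  exact ⟨c, hc, fun D _ χ hD hD3 hq hp =>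
    lt_of_le_of_lt (mul_le_mul_of_nonneg_left (hgg D hD hD3) hc.le) (h D χ (hF hD) hD3 hq hp)⟩

/-- **Bounded families are free** at every positive shape (`exists_const_lt_moduli`). So the open content of a
rung lives on INFINITE families only. [folklore] -/
theorem lOneShapeOn_of_lt {F : Set ℕ} {g : ℕ → ℝ} (hg : ∀ D : ℕ, 3 ≤ D → 0 < g D) {N : ℕ}
    (hF : ∀ D ∈ F, D < N) : LOneShapeOn F g := by
  obtain ⟨c', hc', hsmall⟩ := exists_const_lt_moduli hg N
  exact ⟨c', hc', fun D _ χ hD hD3 _ hp => hsmall D χ hD3 (hF D hD) hp⟩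

/-- A rung is the conjunction of its restrictions to any family and its complement (min of the two
constants). [folklore] -/
theorem lOneShape_of_on_of_on_compl {F : Set ℕ} {g : ℕ → ℝ} (h₁ : LOneShapeOn F g)
    (h₂ : LOneShapeOn Fᶜ g) (hg : ∀ D : ℕ, 3 ≤ D → 0 ≤ g D) : LOneShape g := by
  obtain ⟨c₁, hc₁, h₁⟩ := h₁
  obtain ⟨c₂, hc₂, h₂⟩ := h₂
  refine ⟨min c₁ c₂, lt_min hc₁ hc₂, fun D _ χ hD hq hp => ?_⟩
  by_cases hDF : D ∈ F
  · calc min c₁ c₂ * g D ≤ c₁ * g D := mul_le_mul_of_nonneg_right (min_le_left _ _) (hg D hD)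
      _ < ‖χ.LFunction 1‖ := h₁ D χ hDF hD hq hp
  · calc min c₁ c₂ * g D ≤ c₂ * g D := mul_le_mul_of_nonneg_right (min_le_right _ _) (hg D hD)
      _ < ‖χ.LFunction 1‖ := h₂ D χ hDF hD hq hp

/-- Restriction: a rung gives every family rung. [folklore] -/
theorem lOneShapeOn_of_lOneShape {F : Set ℕ} {g : ℕ → ℝ} (h : LOneShape g) : LOneShapeOn F g :=
  lOneShapeOn_mono (Set.subset_univ F) (fun _ _ _ => le_rfl) ((lOneShapeOn_univ_iff g).2 h)

/-- **Tower-emptiness at width `g`**: no `L(s,χ_D)` (real primitive `χ` mod `D ≥ 3`) has a real zero in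
`[1 − c·g(D), 1)`, for one absolute `c > 0`. [cite: MontgomeryVaughan2007, §11.2 Theorem 11.4 (11.10) (shape)] -/
def RealZeroFreeShape (g : ℕ → ℝ) : Prop :=
  ∃ c : ℝ, 0 < c ∧ ∀ (D : ℕ) [NeZero D] (χ : DirichletCharacter ℂ D), 3 ≤ D → χ.IsQuadratic →
    χ.IsPrimitive → ∀ σ : ℝ, 1 - c * g D ≤ σ → σ < 1 → χ.LFunction σ ≠ 0

/-- **Hecke dictionary, width ⇒ minorant (no loss below `1/log D`)**: if no real zero lies within `c·g(D)` of
`1` and `g(D)·log D ≤ 1`, then `‖L(1,χ)‖ > c'·g(D)` — the tree's resolution form of Hecke–Landau–Page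
(`heckeLandauPageLB_holds`, M–V Thm 11.4 (11.7)/(11.10)). [cite: MontgomeryVaughan2007, §11.2 Theorem 11.4 (11.7) and (11.10)] -/
theorem lOneShape_of_realZeroFreeShape {g : ℕ → ℝ} (hg : ∀ D : ℕ, 3 ≤ D → 0 < g D)
    (hgl : ∀ D : ℕ, 3 ≤ D → g D * Real.log D ≤ 1) (h : RealZeroFreeShape g) : LOneShape g := by
  obtain ⟨c₂, hc₂, η₀, hη₀, H⟩ := heckeLandauPageLB_holds
  obtain ⟨c, hc, hZ⟩ := h
  have hc' : 0 < min c η₀ := lt_min hc hη₀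
  refine ⟨c₂ * min c η₀ / 2, by positivity, fun D _ χ hD hq hp => ?_⟩
  have hne : χ ≠ 1 := ne_one_of_isPrimitive_of_three_le hp hD
  have hgD := hg D hD
  have hθ : 0 < min c η₀ * g D := mul_pos hc' hgD
  have hscale : min c η₀ * g D * Real.log D ≤ η₀ :=
    calc min c η₀ * g D * Real.log D = min c η₀ * (g D * Real.log D) := by ring
      _ ≤ min c η₀ * 1 := mul_le_mul_of_nonneg_left (hgl D hD) hc'.le
      _ ≤ η₀ := by rw [mul_one]; exact min_le_right _ _
  have hzf : ∀ σ : ℝ, 1 - min c η₀ * g D ≤ σ → σ < 1 → χ.LFunction σ ≠ 0 := by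
    intro σ h1 h2
    have hle : min c η₀ * g D ≤ c * g D := mul_le_mul_of_nonneg_right (min_le_left _ _) hgD.le
    exact hZ D χ hD hq hp σ (by linarith) h2
  have key := H D χ hD hne (min c η₀ * g D) hθ hscale hzf
  have e : c₂ * min c η₀ / 2 * g D = c₂ * (min c η₀ * g D) / 2 := by ring
  have hpos : 0 < c₂ * (min c η₀ * g D) := mul_pos hc₂ hθ
  rw [e]
  linarith

/-- `log D > 1` for `D ≥ 3` (private copy; the tree has it under `XYZ`). [folklore] -/
private theorem one_lt_log_of_three_le {D : ℕ} (hD : 3 ≤ D) : 1 < Real.log D := by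
  have hD' : (3 : ℝ) ≤ D := by exact_mod_cast hD
  calc (1 : ℝ) < Real.log 3 := by
        rw [Real.lt_log_iff_exp_lt (by norm_num)]
        exact Real.exp_one_lt_d9.trans (by norm_num)
    _ ≤ Real.log D := Real.log_le_log (by norm_num) hD'

/-- **Hecke dictionary, minorant ⇒ width (loss `log² D`)**: an ∃-rung of shape `g ≤ 1` excludes real zeros
within `c·g(D)/log²D` of `1`, because at an exceptional zero `β` one has `‖L(1,χ)‖ ≤ C₂(1−β)log²D`
(M–V (11.10), tree `MontgomeryVaughan2007_thm11_4_LOne_exceptional_holds`; same bookkeeping as the tree's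
`zeroFree_of_LOne_lower_bound`, which is the case `g = (log D)^{-A}`). [cite: MontgomeryVaughan2007, §11.2 Theorem 11.4 (11.10)] -/
theorem realZeroFreeShape_of_lOneShape {g : ℕ → ℝ} (hg0 : ∀ D : ℕ, 3 ≤ D → 0 ≤ g D)
    (hg1 : ∀ D : ℕ, 3 ≤ D → g D ≤ 1) (h : LOneShape g) :
    RealZeroFreeShape (fun D => g D / Real.log D ^ 2) := by
  obtain ⟨c, hc, C₁, C₂, hC₁, hC₂, hF⟩ := MontgomeryVaughan2007_thm11_4_LOne_exceptional_holds
  obtain ⟨c₁, hc₁, hL⟩ := h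
  refine ⟨min (c / 3) (c₁ / C₂), lt_min (by positivity) (by positivity), ?_⟩
  intro D _ χ hD hq hp σ hσ hσ1 hzero
  dsimp only at hσ
  have hne : χ ≠ 1 := ne_one_of_isPrimitive_of_three_le hp hD
  have hD3 : (3 : ℝ) ≤ D := by exact_mod_cast hD
  set L := Real.log (D : ℝ) with hLdef
  have hlog : 1 < L := one_lt_log_of_three_le hD
  have hLpos : 0 < L := by linarith
  have hL2 : 0 < L ^ 2 := by positivity
  have hgL : 0 ≤ g D / L ^ 2 := div_nonneg (hg0 D hD) hL2.le
  -- the zero lies in the exceptional range `1 − c/log 4D < σ`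
  have h4qpos : 0 < Real.log (4 * D) := Real.log_pos (by linarith)
  have h4q : Real.log (4 * D) ≤ 3 * L := log_four_mul_le_three_mul_log (by linarith)
  have step1 : min (c / 3) (c₁ / C₂) * (g D / L ^ 2) ≤ c / 3 * (1 / L ^ 2) :=
    mul_le_mul (min_le_left _ _) (by gcongr; exact hg1 D hD) hgL (by positivity)
  have step2 : c / 3 * (1 / L ^ 2) < c / 3 * (1 / L) := by
    apply mul_lt_mul_of_pos_left _ (by positivity)
    rw [one_div_lt_one_div hL2 hLpos]
    nlinarith
  have step3 : c / 3 * (1 / L) ≤ c / Real.log (4 * D) := by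
    rw [show c / 3 * (1 / L) = c / (3 * L) by field_simp]
    exact div_le_div_of_nonneg_left hc.le h4qpos h4q
  have hreg : 1 - c / Real.log (4 * D) < σ := by linarith
  have hup : ‖χ.LFunction 1‖ ≤ C₂ * (1 - σ) * Real.log D ^ 2 := (hF D χ hne hq σ hreg hσ1 hzero).2
  -- and then `‖L(1,χ)‖ ≤ C₂ (1−σ) log²D ≤ c₁ g(D)`, contradicting the rung
  have h1σ : 1 - σ ≤ c₁ / C₂ * (g D / L ^ 2) := by
    have := mul_le_mul_of_nonneg_right (min_le_right (c / 3) (c₁ / C₂)) hgL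
    linarith
  have hchain : C₂ * (1 - σ) * Real.log D ^ 2 ≤ C₂ * (c₁ / C₂ * (g D / L ^ 2)) * L ^ 2 := by
    rw [← hLdef]
    exact mul_le_mul_of_nonneg_right (mul_le_mul_of_nonneg_left h1σ hC₂.le) hL2.le
  have hsimp : C₂ * (c₁ / C₂ * (g D / L ^ 2)) * L ^ 2 = c₁ * g D := by
    field_simp
  have hlow := hL D χ hD hq hp
  linarith

/-! ## Part B — the genus rail (explicit rail, structure-valued): one class per genus beyond Euler's table -/

open Literature.NumberTheory.QuadraticFields.Quadratic
open Literature.NumberTheory.QuadraticFields.BinaryQuadraticForm (assignedCharCount)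

/-- **One class per genus at discriminant `D`** (decidable): every reduced primitive positive-definite form
`(a,b,c)` of discriminant `D` is ambiguous, `b = 0 ∨ b = a ∨ a = c` — Cox Thm 3.22 (ii); ⟺ `h(D) = 2^{μ−1}`
⟺ the form class group `C(D)` has exponent `≤ 2` (tree `classNumber_eq_two_pow_iff_forall_ambiguous`,
`forall_ambiguous_iff_forall_sq_eq_one`). [cite: Cox2013, §3.C Thm. 3.22 (ii)] -/
def OneClassPerGenus (D : ℤ) : Prop :=
  ∀ g ∈ BinQF.reducedFormsList D, g.b = 0 ∨ g.b = g.a ∨ g.a = g.c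

/-- h-currency: one class per genus ⟺ `h(D) = 2^{μ−1}` (tree). [cite: Cox2013, §3.C Thm. 3.22 ((ii) ⟺ (v))] -/
theorem oneClassPerGenus_iff_classNumber_eq {D : ℤ} (hD : D < 0) (h4 : D % 4 = 0 ∨ D % 4 = 1) :
    OneClassPerGenus D ↔ BinQF.classNumber D = 2 ^ (assignedCharCount D - 1) :=
  (classNumber_eq_two_pow_iff_forall_ambiguous hD h4).symm

/-- **The genus-rail rung at height `N`**: no discriminant `D < −N` (`D ≡ 0, 1 mod 4`) has one class per genus.
OPEN for every `N` (the rung `N = 7392 = 4·1848` is «Euler's table of 65 numeri idonei and Gauss's table of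
one-class-per-genus discriminants are complete»; Weinberger 1973: at most one fundamental `D` beyond; none on
GRH; Cox p. 62: "it is not known if it is complete"). An EXPLICIT leaf `c₁/(log D)^A < L(1,χ_D)` decides it for
`N` above the crossover `c₁√N/(π (log N)^A) > τ(N)` via `h(D) = √|D| L(1,χ_D)/π > 2^{ω(|D|)} ≥ 2^{μ−1}`;
the ∃-leaf decides only `∃ N, …` (Chowla 1934, known). [cite: Cox2013, §3.C Thm. 3.22 and the remarks after Prop. 3.24] [cite: Weinberger1973Exponents, Theorem 1] -/
def NoOneClassPerGenusBeyond (N : ℕ) : Prop :=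
  ∀ D : ℤ, D < -(N : ℤ) → (D % 4 = 0 ∨ D % 4 = 1) → ¬ OneClassPerGenus D

/-- h-currency reading of the rung: `h(D) ≠ 2^{μ−1}` (equivalently `h(D) ≥ 2^{μ}`, as `2^{μ−1} ∣ h(D)`) for all
`D < −N`. [cite: Cox2013, §3.C Thm. 3.22 ((ii) ⟺ (v))] -/
theorem noOneClassPerGenusBeyond_iff_classNumber_ne (N : ℕ) :
    NoOneClassPerGenusBeyond N ↔
      ∀ D : ℤ, D < -(N : ℤ) → (D % 4 = 0 ∨ D % 4 = 1) →
        BinQF.classNumber D ≠ 2 ^ (assignedCharCount D - 1) := by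
  refine forall_congr' fun D => forall_congr' fun hD => forall_congr' fun h4 => ?_
  rw [oneClassPerGenus_iff_classNumber_eq (by omega) h4]

/-- The rail is monotone: a higher threshold is a weaker rung. [folklore] -/
theorem noOneClassPerGenusBeyond_mono {N N' : ℕ} (hNN : N ≤ N') (h : NoOneClassPerGenusBeyond N) :
    NoOneClassPerGenusBeyond N' :=
  fun D hD h4 => h D (by omega) h4

/-- **Finite-window bookkeeping** (the `finite`-lens shape of the rail): a rung at a high threshold `N'` plus a
CHECK of the window `−N' ≤ D < −N` gives the rung at `N`. [folklore] -/
theorem noOneClassPerGenusBeyond_of_window {N N' : ℕ}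
    (hwin : ∀ D : ℤ, -(N' : ℤ) ≤ D → D < -(N : ℤ) → (D % 4 = 0 ∨ D % 4 = 1) → ¬ OneClassPerGenus D)
    (h : NoOneClassPerGenusBeyond N') : NoOneClassPerGenusBeyond N := by
  intro D hD h4
  by_cases hw : -(N' : ℤ) ≤ D
  · exact hwin D hw hD h4
  · exact h D (by omega) h4

/-- Kernel instances ON Euler's/Gauss's tables: `−3315 = −3·5·13·17` (odd, `h = 8 = 2³`), `−5460 = −4·1365`
(`h = 16`), `−7392 = −4·1848` (`h = 16`, the largest known) have one class per genus. [cite: Cox2013, §3.C (table of the 65 `n`'s)] -/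
theorem oneClassPerGenus_tables :
    OneClassPerGenus (-3315) ∧ OneClassPerGenus (-5460) ∧ OneClassPerGenus (-7392) := by
  unfold OneClassPerGenus
  refine ⟨?_, ?_, ?_⟩ <;> decide +kernel

/-- Kernel window just beyond the table: none of the eight discriminants `D ≡ 0,1 (mod 4)` with
`−7408 ≤ D < −7392` has one class per genus. [folklore] -/
theorem not_oneClassPerGenus_window :
    ∀ D ∈ ([-7395, -7396, -7399, -7400, -7403, -7404, -7407, -7408] : List ℤ), ¬ OneClassPerGenus D := by
  unfold OneClassPerGenus
  decide +kernel

/-- … hence the rung at `7392` follows from the rung at `7408` (toy instance of the window bookkeeping; the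
computed window in print reaches `|D| ≤ 3.1·10²⁰` for fundamental `D`, arXiv:1803.02056 Thm 2). [folklore] -/
theorem noOneClassPerGenusBeyond_7392_of_7408 (h : NoOneClassPerGenusBeyond 7408) :
    NoOneClassPerGenusBeyond 7392 := by
  refine noOneClassPerGenusBeyond_of_window (fun D hlo hhi h4 => ?_) h
  have hmem : D ∈ ([-7395, -7396, -7399, -7400, -7403, -7404, -7407, -7408] : List ℤ) := by
    simp only [List.mem_cons, List.mem_nil_iff, or_false]
    omega
  exact not_oneClassPerGenus_window D hmem

/-- **The convenient-number rung at height `N`** (PARAMETRIC; the explicit-rail companion of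
`NoOneClassPerGenusBeyond (4N)` on the discriminants `−4n`): no `n > N` is a convenient number. At `N = 1848`
this is «Euler's table of 65 numeri idonei is complete beyond its largest entry» — OPEN since 1778 (Weinberger
1973: at most one convenient number is missing; none on GRH); the tree has the 65 and that each IS convenient
(`isConvenientNumber_of_mem_eulerConvenientNumbers`), completeness is "NOT here" there, and not claimed here.
[cite: Cox2013, §3.C (remarks after Prop. 3.24)] [cite: Weinberger1973Exponents, Theorem 1] -/
def NoConvenientNumberBeyond (N : ℕ) : Prop :=
  ∀ n : ℕ, N < n → ¬ IsConvenientNumber n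

/-- The rung is monotone: a higher threshold is a weaker rung. [folklore] -/
theorem noConvenientNumberBeyond_mono {N N' : ℕ} (hNN : N ≤ N') (h : NoConvenientNumberBeyond N) :
    NoConvenientNumberBeyond N' :=
  fun n hn => h n (by omega)

/-- Every number in Euler's table is `≤ 1848`. [cite: Cox2013, §3.C (table of the 65 `n`'s)] -/
theorem le_1848_of_mem_eulerConvenientNumbers {n : ℕ} (hn : n ∈ eulerConvenientNumbers) : n ≤ 1848 := by
  have key : ∀ k ∈ eulerConvenientNumbers, k ≤ 1848 := by decide
  exact key n hn

/-- **Euler-completeness gives the rung at `1848`** (PROVED bookkeeping): if every convenient number is one of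
Euler's 65 (hypothesis inlined — an OPEN statement, not a fact), then no `n > 1848` is convenient.
[cite: Cox2013, §3.C (remarks after Prop. 3.24)] -/
theorem noConvenientNumberBeyond_1848_of_eulerListComplete
    (h : ∀ n : ℕ, IsConvenientNumber n → n ∈ eulerConvenientNumbers) : NoConvenientNumberBeyond 1848 := by
  intro n hn hconv
  have := le_1848_of_mem_eulerConvenientNumbers (h n hconv)
  omega

/-- **The convenient-number rung gives the genus rail on the discriminants `−4n`** (PROVED direction; the
converse needs Cox Prop. 3.24 ⟹, i.e. Thm. 9.12, not in tree): if no `n > N ≥ 1` is convenient then no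
`D = −4n`, `n > N`, has one class per genus (tree `isConvenientNumber_of_forall_ambiguous`, Prop. 3.24 ⟸).
[cite: Cox2013, §3.C Prop. 3.24 with Thm. 3.22] -/
theorem not_oneClassPerGenus_neg_four_mul_of_noConvenientNumberBeyond {N : ℕ} (hN : 1 ≤ N)
    (h : NoConvenientNumberBeyond N) {n : ℕ} (hn : N < n) : ¬ OneClassPerGenus (-4 * (n : ℤ)) := by
  intro hocpg
  exact h n hn (isConvenientNumber_of_forall_ambiguous (by omega) hocpg)

/-- **Euler-completeness gives the genus rail on the discriminants `−4n`** (PROVED direction, hypothesis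
inlined): if Euler's list is complete then no `D = −4n`, `n > 1848`, has one class per genus.
[cite: Cox2013, §3.C Prop. 3.24 with Thm. 3.22] -/
theorem not_oneClassPerGenus_neg_four_mul_of_eulerListComplete
    (h : ∀ n : ℕ, IsConvenientNumber n → n ∈ eulerConvenientNumbers) {n : ℕ}
    (hn : 1848 < n) : ¬ OneClassPerGenus (-4 * (n : ℤ)) :=
  not_oneClassPerGenus_neg_four_mul_of_noConvenientNumberBeyond (by norm_num)
    (noConvenientNumberBeyond_1848_of_eulerListComplete h) hn

/-- Conversely the genus rail at `7392` contains the `−4n` statement outright. [folklore] -/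
theorem not_oneClassPerGenus_neg_four_mul_of_rail (h : NoOneClassPerGenusBeyond 7392) {n : ℕ}
    (hn : 1848 < n) : ¬ OneClassPerGenus (-4 * (n : ℤ)) :=
  h _ (by push_cast; omega) (Or.inl (by omega))

end Summit.Parity.GeneralizedHardyLittlewood.Theorems.PrimeLevelFamEdgeIdeaDeltas.Wuc

end
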